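import Summits.Ventures.PercRepro.Night2OneFatCaseOneGeomC
import Summits.Ventures.PercRepro.Night2OneFatCaseOneTypes

/-!
# PercRepro — the case-1 assembly, part A: the closure property of the face hyperplanes (night-2, gen 29)

Setting (proofs/NIGHT-2-g29.md §4⁗ E): `S ⊆ G` containing `K`, `S ∖ K` of rank `5`, `coloops (S ∖ K) = {w}`; three points
`y₁, y₂, y₃` of `S ∖ K`, none a coloop of `S ∖ K`, `y₂, y₃` coloops of `(S ∖ K) ∖ y₁`; `P = ((S ∖ y₁) ∖ y₂) ∖ y₃` and the
face hyperplanes `H′_a = cl (insert y_a P)`.  **`closureProp_faces`**: a point in two of the `H′_a` lies in the third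
(`ClosureProp`), by `mem_clF_third_face_of_mem_two` applied to the symmetric triple (`coloops_erase_of_triple`) off `K`
and lifted through `K` (`mem_clF_sdiff_coloops_of_mem_clF_insert`).
-/

namespace PercRepro.Shadow

open Finset PerFlat ThmH

variable {α : Type*} [DecidableEq α] {M : Matroid α} [M.Finite] {G : Finset α}

section AssemblyA

/-- The base off `K`. -/
theorem base_sdiff_coloops (S : Finset α) (y₁ y₂ y₃ : α) :
    (((S.erase y₁).erase y₂).erase y₃) \ coloops M G = (((S \ coloops M G).erase y₁).erase y₂).erase y₃ := by
  ext a; simp only [Finset.mem_sdiff, Finset.mem_erase]; tauto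

/-- One implication of the closure property, for an ordered triple `(y₁; y₂, y₃)`: a point of `cl (insert y₁ P) ∩ cl (insert y₂ P)`
lies in `cl (insert y₃ P)` (`P` with `K`). -/
theorem mem_clF_third_of_two (hG : G ∈ flatsQ M (5 + 1)) (hk : kColoops M G = 1) {S : Finset α} (hSG : S ⊆ G)
    (hKS : coloops M G ⊆ S) (hS5 : rkN M (S \ coloops M G) = 5) {y₁ y₂ y₃ : α}
    (hy₁ : y₁ ∈ S \ coloops M G) (hy₂ : y₂ ∈ S \ coloops M G) (hy₃ : y₃ ∈ S \ coloops M G)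
    (h12 : y₁ ≠ y₂) (h13 : y₁ ≠ y₃) (h23 : y₂ ≠ y₃) (hc₃ : y₃ ∉ coloops M (S \ coloops M G))
    (hcol₂ : y₂ ∈ coloops M ((S \ coloops M G).erase y₁)) (hcol₃ : y₃ ∈ coloops M ((S \ coloops M G).erase y₁))
    {x : α} (hx₁ : x ∈ clF M (insert y₁ (((S.erase y₁).erase y₂).erase y₃)))
    (hx₂ : x ∈ clF M (insert y₂ (((S.erase y₁).erase y₂).erase y₃))) :
    x ∈ clF M (insert y₃ (((S.erase y₁).erase y₂).erase y₃)) := by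
  have hGg : G ⊆ gr M := (mem_flatsQ.1 hG).1
  set P := ((S.erase y₁).erase y₂).erase y₃ with hP
  set P' := (((S \ coloops M G).erase y₁).erase y₂).erase y₃ with hP'
  have hPG : P ⊆ G := ((Finset.erase_subset _ _).trans ((Finset.erase_subset _ _).trans
    (Finset.erase_subset _ _))).trans hSG
  have hP'V : P' ⊆ G \ coloops M G := by
    rw [hP', ← base_sdiff_coloops]
    exact Finset.sdiff_subset_sdiff hPG (Finset.Subset.refl _)
  -- the coloop of `G`
  have hcard1 : (coloops M G).card = 1 := by rw [← kColoops_eq_card_coloops (M := M) G]; exact hk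
  obtain ⟨e₀, he₀⟩ := Finset.card_eq_one.1 hcard1
  have he₀c : e₀ ∈ coloops M G := by rw [he₀]; exact Finset.mem_singleton_self _
  have he₀P : e₀ ∈ P := by
    have he₀S : e₀ ∈ S := hKS he₀c
    have h1 : e₀ ≠ y₁ := fun h => (Finset.mem_sdiff.1 hy₁).2 (h ▸ he₀c)
    have h2 : e₀ ≠ y₂ := fun h => (Finset.mem_sdiff.1 hy₂).2 (h ▸ he₀c)
    have h3 : e₀ ≠ y₃ := fun h => (Finset.mem_sdiff.1 hy₃).2 (h ▸ he₀c)
    exact Finset.mem_erase.2 ⟨h3, Finset.mem_erase.2 ⟨h2, Finset.mem_erase.2 ⟨h1, he₀S⟩⟩⟩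
  have hPeq : ∀ y, insert y P = insert e₀ (insert y P') := by
    intro y
    ext a
    simp only [Finset.mem_insert, hP, hP', Finset.mem_erase, Finset.mem_sdiff, he₀, Finset.mem_singleton]
    constructor
    · rintro (rfl | ⟨h3, h2, h1, hS⟩)
      · exact Or.inr (Or.inl rfl)
      · by_cases hae : a = e₀
        · exact Or.inl hae
        · exact Or.inr (Or.inr ⟨h3, h2, h1, hS, hae⟩)
    · rintro (rfl | rfl | ⟨h3, h2, h1, hS, -⟩)
      · exact Or.inr (Finset.mem_erase.1 he₀P |>.elim fun a b => ⟨a, (Finset.mem_erase.1 b).1,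
          (Finset.mem_erase.1 (Finset.mem_erase.1 b).2).1, (Finset.mem_erase.1 (Finset.mem_erase.1 b).2).2⟩)
      · exact Or.inl rfl
      · exact Or.inr ⟨h3, h2, h1, hS⟩
  -- the point lies in `G`; if it is `e₀` it is in every face; else remove `K` and use P1 off `K`
  have hxG : x ∈ G := clF_subset_of_subset_flatsQ hG (Finset.insert_subset (hSG (Finset.mem_sdiff.1 hy₁).1) hPG) hx₁
  by_cases hxK : x ∈ coloops M G
  · have : x = e₀ := by rw [he₀] at hxK; exact Finset.mem_singleton.1 hxK
    rw [this]
    exact subset_clF_of_subset_gr (Finset.insert_subset (hGg (hSG (Finset.mem_sdiff.1 hy₃).1)) (hPG.trans hGg))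
      (Finset.mem_insert_of_mem he₀P)
  have hxV : x ∈ G \ coloops M G := Finset.mem_sdiff.2 ⟨hxG, hxK⟩
  have hyV : ∀ y ∈ S \ coloops M G, y ∈ G \ coloops M G := fun y hy =>
    Finset.sdiff_subset_sdiff hSG (Finset.Subset.refl _) hy
  have hx₁' : x ∈ clF M (insert y₁ P') :=
    mem_clF_sdiff_coloops_of_mem_clF_insert hG he₀ (Finset.insert_subset (hyV y₁ hy₁) hP'V) hxV
      (by rw [← hPeq]; exact hx₁)
  have hx₂' : x ∈ clF M (insert y₂ P') :=
    mem_clF_sdiff_coloops_of_mem_clF_insert hG he₀ (Finset.insert_subset (hyV y₂ hy₂) hP'V) hxV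
      (by rw [← hPeq]; exact hx₂)
  have hVg : S \ coloops M G ⊆ gr M := Finset.sdiff_subset.trans (hSG.trans hGg)
  have hx₃' := mem_clF_third_face_of_mem_two hVg hS5 hy₁ hy₂ hy₃ h12 h13 h23 hc₃ hcol₂ hcol₃ (hGg hxG) hx₁' hx₂'
  rw [hPeq y₃]
  exact clF_mono (Finset.subset_insert _ _) hx₃'


/-- **THE CLOSURE PROPERTY OF THE FACE HYPERPLANES** `H′_a = cl (insert y_a P)`: a point in two of them lies in the third. -/
theorem closureProp_faces (hG : G ∈ flatsQ M (5 + 1)) (hk : kColoops M G = 1) {S : Finset α} (hSG : S ⊆ G)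
    (hKS : coloops M G ⊆ S) (hS5 : rkN M (S \ coloops M G) = 5) {y₁ y₂ y₃ : α}
    (hy₁ : y₁ ∈ S \ coloops M G) (hy₂ : y₂ ∈ S \ coloops M G) (hy₃ : y₃ ∈ S \ coloops M G)
    (h12 : y₁ ≠ y₂) (h13 : y₁ ≠ y₃) (h23 : y₂ ≠ y₃) (hc₁ : y₁ ∉ coloops M (S \ coloops M G))
    (hc₂ : y₂ ∉ coloops M (S \ coloops M G)) (hc₃ : y₃ ∉ coloops M (S \ coloops M G))
    (hcol₂ : y₂ ∈ coloops M ((S \ coloops M G).erase y₁)) (hcol₃ : y₃ ∈ coloops M ((S \ coloops M G).erase y₁)) :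
    ClosureProp (fun x => x ∈ clF M (insert y₁ (((S.erase y₁).erase y₂).erase y₃)))
      (fun x => x ∈ clF M (insert y₂ (((S.erase y₁).erase y₂).erase y₃)))
      (fun x => x ∈ clF M (insert y₃ (((S.erase y₁).erase y₂).erase y₃))) := by
  have hGg : G ⊆ gr M := (mem_flatsQ.1 hG).1
  have hVg : S \ coloops M G ⊆ gr M := Finset.sdiff_subset.trans (hSG.trans hGg)
  -- the symmetric triple
  obtain ⟨hcol₁', hcol₃'⟩ := coloops_erase_of_triple hVg hS5 (Finset.mem_sdiff.1 hy₁ |>.elim fun a b => Finset.mem_sdiff.2 ⟨a, b⟩)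
    hy₂ hy₃ h12 h13 h23 hc₂ hc₃ hcol₂ hcol₃
  -- the three bases coincide
  have hP231 : ((S.erase y₂).erase y₃).erase y₁ = ((S.erase y₁).erase y₂).erase y₃ := by
    ext a; simp only [Finset.mem_erase]; tauto
  have hP132 : ((S.erase y₁).erase y₃).erase y₂ = ((S.erase y₁).erase y₂).erase y₃ := by
    ext a; simp only [Finset.mem_erase]; tauto
  refine ⟨?_, ?_, ?_⟩
  · -- `A₂ ∧ A₃ → A₁`: the triple `(y₂; y₃, y₁)`
    intro x hx₂ hx₃
    have := mem_clF_third_of_two hG hk hSG hKS hS5 hy₂ hy₃ hy₁ h23 h12.symm h13.symm hc₁ hcol₃' hcol₁'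
      (by rw [hP231]; exact hx₂) (by rw [hP231]; exact hx₃)
    rw [hP231] at this
    exact this
  · -- `A₁ ∧ A₃ → A₂`: the triple `(y₁; y₃, y₂)`
    intro x hx₁ hx₃
    have := mem_clF_third_of_two hG hk hSG hKS hS5 hy₁ hy₃ hy₂ h13 h12 h23.symm hc₂ hcol₃ hcol₂
      (by rw [hP132]; exact hx₁) (by rw [hP132]; exact hx₃)
    rw [hP132] at this
    exact this
  · -- `A₁ ∧ A₂ → A₃`
    intro x hx₁ hx₂
    exact mem_clF_third_of_two hG hk hSG hKS hS5 hy₁ hy₂ hy₃ h12 h13 h23 hc₃ hcol₂ hcol₃ hx₁ hx₂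


/-- `w ∉ cl (S ∖ w)` for the coloop `w` of `S ∖ K` (`K ⊆ S`, `w ∉ K`): lifting `w ∉ cl ((S ∖ K) ∖ w)` through `K`. -/
theorem coloop_notMem_clF_erase (hG : G ∈ flatsQ M (5 + 1)) (hk : kColoops M G = 1) {S : Finset α} (hSG : S ⊆ G)
    (hKS : coloops M G ⊆ S) {w : α} (hw : w ∈ coloops M (S \ coloops M G)) : w ∉ clF M (S.erase w) := by
  intro hcl
  have hwS : w ∈ S \ coloops M G := (mem_coloops.1 hw).1
  have hwK : w ∉ coloops M G := (Finset.mem_sdiff.1 hwS).2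
  have hcard1 : (coloops M G).card = 1 := by rw [← kColoops_eq_card_coloops (M := M) G]; exact hk
  obtain ⟨e₀, he₀⟩ := Finset.card_eq_one.1 hcard1
  have he₀c : e₀ ∈ coloops M G := by rw [he₀]; exact Finset.mem_singleton_self _
  have he₀S : e₀ ∈ S := hKS he₀c
  have hne : e₀ ≠ w := fun h => hwK (h ▸ he₀c)
  have heq : S.erase w = insert e₀ ((S \ coloops M G).erase w) := by
    ext a
    simp only [Finset.mem_erase, Finset.mem_insert, Finset.mem_sdiff, he₀, Finset.mem_singleton]
    constructor
    · rintro ⟨haw, haS⟩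
      by_cases hae : a = e₀
      · exact Or.inl hae
      · exact Or.inr ⟨haw, haS, hae⟩
    · rintro (rfl | ⟨haw, haS, -⟩)
      · exact ⟨hne, he₀S⟩
      · exact ⟨haw, haS⟩
  rw [heq] at hcl
  have hwV : w ∈ G \ coloops M G := Finset.mem_sdiff.2 ⟨hSG (Finset.mem_sdiff.1 hwS).1, hwK⟩
  have := mem_clF_sdiff_coloops_of_mem_clF_insert hG he₀ ((Finset.erase_subset _ _).trans
    (Finset.sdiff_subset_sdiff hSG (Finset.Subset.refl _))) hwV hcl
  exact (mem_coloops.1 hw).2 this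

/-- **`|G ∖ H| = 1 + #{x ∈ G ∖ S : x ∉ H}`** for `H = cl (S ∖ w)`. -/
theorem card_sdiff_clF_erase_coloop (hG : G ∈ flatsQ M (5 + 1)) (hk : kColoops M G = 1) {S : Finset α} (hSG : S ⊆ G)
    (hKS : coloops M G ⊆ S) {w : α} (hw : w ∈ coloops M (S \ coloops M G)) :
    (G \ clF M (S.erase w)).card = 1 + ((G \ S).filter (fun x => x ∉ clF M (S.erase w))).card := by
  have hGg : G ⊆ gr M := (mem_flatsQ.1 hG).1
  have hwS : w ∈ S := (Finset.mem_sdiff.1 (mem_coloops.1 hw).1).1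
  have hwn : w ∉ clF M (S.erase w) := coloop_notMem_clF_erase hG hk hSG hKS hw
  have heq : G \ clF M (S.erase w) = insert w ((G \ S).filter (fun x => x ∉ clF M (S.erase w))) := by
    ext a
    simp only [Finset.mem_sdiff, Finset.mem_insert, Finset.mem_filter]
    constructor
    · rintro ⟨haG, hacl⟩
      by_cases haw : a = w
      · exact Or.inl haw
      · right
        refine ⟨⟨haG, fun haS => hacl ?_⟩, hacl⟩
        exact subset_clF_of_subset_gr ((Finset.erase_subset _ _).trans (hSG.trans hGg)) (Finset.mem_erase.2 ⟨haw, haS⟩)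
    · rintro (rfl | ⟨⟨haG, -⟩, hacl⟩)
      · exact ⟨hSG hwS, hwn⟩
      · exact ⟨haG, hacl⟩
  rw [heq, Finset.card_insert_of_notMem]
  · ring
  · rw [Finset.mem_filter, Finset.mem_sdiff]
    rintro ⟨⟨-, hwS'⟩, -⟩
    exact hwS' hwS

/-- **`|G ∖ H′_a| = 2 + #{x ∈ G ∖ S : x ∉ H′_a}`** for `H′_a = cl ((S ∖ y_b) ∖ y_c)`, `y_c` a coloop of `(S ∖ K) ∖ y_b` and `y_b` one of
`(S ∖ K) ∖ y_c`, neither a coloop of `S ∖ K` (of rank `5`). -/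
theorem card_sdiff_clF_face_pair (hG : G ∈ flatsQ M (5 + 1)) (hk : kColoops M G = 1) {S : Finset α} (hSG : S ⊆ G)
    (hKS : coloops M G ⊆ S) (hS5 : rkN M (S \ coloops M G) = 5) {y₁ y₂ : α} (hy₁ : y₁ ∈ S \ coloops M G)
    (hy₂ : y₂ ∈ S \ coloops M G) (h12 : y₁ ≠ y₂) (hc₁ : y₁ ∉ coloops M (S \ coloops M G))
    (hc₂ : y₂ ∉ coloops M (S \ coloops M G)) (hcol₂ : y₂ ∈ coloops M ((S \ coloops M G).erase y₁))
    (hcol₁ : y₁ ∈ coloops M ((S \ coloops M G).erase y₂)) :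
    (G \ clF M ((S.erase y₁).erase y₂)).card = 2 + ((G \ S).filter (fun x => x ∉ clF M ((S.erase y₁).erase y₂))).card := by
  have hGg : G ⊆ gr M := (mem_flatsQ.1 hG).1
  have hVg : S \ coloops M G ⊆ gr M := Finset.sdiff_subset.trans (hSG.trans hGg)
  have hcard1 : (coloops M G).card = 1 := by rw [← kColoops_eq_card_coloops (M := M) G]; exact hk
  obtain ⟨e₀, he₀⟩ := Finset.card_eq_one.1 hcard1
  have he₀c : e₀ ∈ coloops M G := by rw [he₀]; exact Finset.mem_singleton_self _
  have he₀S : e₀ ∈ S := hKS he₀c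
  have hyV : ∀ y ∈ S \ coloops M G, y ∈ G \ coloops M G := fun y hy =>
    Finset.sdiff_subset_sdiff hSG (Finset.Subset.refl _) hy
  -- the face with and without `K`
  have heq : (S.erase y₁).erase y₂ = insert e₀ (((S \ coloops M G).erase y₁).erase y₂) := by
    ext a
    simp only [Finset.mem_erase, Finset.mem_insert, Finset.mem_sdiff, he₀, Finset.mem_singleton]
    constructor
    · rintro ⟨ha2, ha1, haS⟩
      by_cases hae : a = e₀
      · exact Or.inl hae
      · exact Or.inr ⟨ha2, ha1, haS, hae⟩
    · rintro (rfl | ⟨ha2, ha1, haS, -⟩)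
      · exact ⟨fun h => (Finset.mem_sdiff.1 hy₂).2 (h ▸ he₀c), fun h => (Finset.mem_sdiff.1 hy₁).2 (h ▸ he₀c), he₀S⟩
      · exact ⟨ha2, ha1, haS⟩
  -- `y₁, y₂ ∉ H′` (Claim B off `K`, lifted)
  have hy₁5 : rkN M ((S \ coloops M G).erase y₁) = 5 := by rw [rkN_erase_of_not_coloop hVg hy₁ hc₁, hS5]
  have hy₂5 : rkN M ((S \ coloops M G).erase y₂) = 5 := by rw [rkN_erase_of_not_coloop hVg hy₂ hc₂, hS5]
  have hn₁ : y₁ ∉ clF M ((S.erase y₁).erase y₂) := by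
    intro hcl
    rw [heq] at hcl
    have := mem_clF_sdiff_coloops_of_mem_clF_insert hG he₀ (((Finset.erase_subset _ _).trans
      (Finset.erase_subset _ _)).trans (Finset.sdiff_subset_sdiff hSG (Finset.Subset.refl _))) (hyV y₁ hy₁) hcl
    exact notMem_clF_face_of_not_coloop hVg hS5 hy₁ hy₁5 hcol₂ hc₂ this
  have hn₂ : y₂ ∉ clF M ((S.erase y₁).erase y₂) := by
    intro hcl
    rw [heq] at hcl
    have := mem_clF_sdiff_coloops_of_mem_clF_insert hG he₀ (((Finset.erase_subset _ _).trans
      (Finset.erase_subset _ _)).trans (Finset.sdiff_subset_sdiff hSG (Finset.Subset.refl _))) (hyV y₂ hy₂) hcl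
    have h' : y₂ ∈ clF M (((S \ coloops M G).erase y₂).erase y₁) := by
      rw [Finset.erase_right_comm]; exact this
    exact notMem_clF_face_of_not_coloop hVg hS5 hy₂ hy₂5 hcol₁ hc₁ h'
  have hy₁S : y₁ ∈ S := (Finset.mem_sdiff.1 hy₁).1
  have hy₂S : y₂ ∈ S := (Finset.mem_sdiff.1 hy₂).1
  have hset : G \ clF M ((S.erase y₁).erase y₂) =
      insert y₁ (insert y₂ ((G \ S).filter (fun x => x ∉ clF M ((S.erase y₁).erase y₂)))) := by
    ext a
    simp only [Finset.mem_sdiff, Finset.mem_insert, Finset.mem_filter]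
    constructor
    · rintro ⟨haG, hacl⟩
      by_cases ha1 : a = y₁
      · exact Or.inl ha1
      by_cases ha2 : a = y₂
      · exact Or.inr (Or.inl ha2)
      right; right
      refine ⟨⟨haG, fun haS => hacl ?_⟩, hacl⟩
      exact subset_clF_of_subset_gr (((Finset.erase_subset _ _).trans (Finset.erase_subset _ _)).trans (hSG.trans hGg))
        (Finset.mem_erase.2 ⟨ha2, Finset.mem_erase.2 ⟨ha1, haS⟩⟩)
    · rintro (rfl | rfl | ⟨⟨haG, -⟩, hacl⟩)
      · exact ⟨hSG hy₁S, hn₁⟩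
      · exact ⟨hSG hy₂S, hn₂⟩
      · exact ⟨haG, hacl⟩
  rw [hset, Finset.card_insert_of_notMem, Finset.card_insert_of_notMem]
  · ring
  · rw [Finset.mem_filter, Finset.mem_sdiff]
    rintro ⟨⟨-, h⟩, -⟩
    exact h hy₂S
  · rw [Finset.mem_insert, Finset.mem_filter, Finset.mem_sdiff]
    rintro (h | ⟨⟨-, h⟩, -⟩)
    · exact h12 h
    · exact h hy₁S

end AssemblyA

end PercRepro.Shadow
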